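import Literature.Geometry.Kaehler.FubiniStudy
import HarnessLib

/-!
# The Chern connection form of the Fubini–Study metric on the tautological line, upstairs

Layer `Literature/Geometry/Kaehler`. Companion of `FubiniStudy` (the Fubini–Study `2`-form
`β₀ = dα₀` of a complex inner product space `W` off the origin and its pull-back `G^*β₀` along
holomorphic maps). This file adds the **connection `1`-form**

  `γ₀(Z)(a) = ⟪Z, a⟫ / ‖Z‖²`  (`fubiniStudyConnectionPotential`; `⟪·,·⟫` conjugate-linear in `Z`),

a complex-valued real-linear `1`-form on `W ∖ {0}`: `γ₀ = ∂ log ‖Z‖²`, i.e.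
`Re γ₀ = ½ d log ‖Z‖²` and `Im γ₀ = α₀` (the Fubini–Study potential of `FubiniStudy`). For a
holomorphic, nowhere-vanishing local frame `G : U → W ∖ {0}` of the tautological line (e.g. the
affine coordinates `Gⱼ = (xᵢ/xⱼ)ᵢ` of a projective manifold on the chart `xⱼ ≠ 0`), the pulled-back
form `G^*γ₀ = ∂ log ‖G‖²` is the connection form, in the frame `G`, of the Chern connection of the
metric `h(G, G) = ‖G‖²` induced by `W` on the tautological line bundle `𝒪(-1)`, and `-G^*γ₀` is the
connection form of the dual metric `h = 1/‖G‖²` on the hyperplane bundle `𝒪(1)` in the dual frame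
(Griffiths–Harris (1978), p. 73: for a line bundle with metric `h` in a holomorphic frame the
Chern connection is `θ = ∂ log h` with curvature `Θ = ∂̄∂ log h`; pp. 30–31 and 141: for `𝒪(1)`
with the metric induced from `ℂⁿ⁺¹`, `(i/2π) Θ` is the Fubini–Study form; Voisin (2002), §3.3.1,
Def. 3.5 of the Chern form `ω = (1/2iπ) ∂∂̄ log h` and §3.3.2, proof of Lemma 3.16:
`∂̄ log (1/(1+|z|²))`, and Thm. 3.13 / (3.11)). ALL PROVED here, by explicit real calculus:

* `fubiniStudyConnectionPotential`, `_apply`, `contDiffAt_…` (`C^∞` off `0`);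
* `extDeriv_fubiniStudyConnectionPotential_apply` — **`dγ₀ = i β₀`** (`β₀ = fubiniStudyForm`):
  the curvature `dγ₀` of the connection form is `i` times the Fubini–Study form, i.e.
  `(i/2π) · (curvature of 𝒪(1)) = (1/2π) β₀` (Griffiths–Harris p. 30; Voisin Lemma 3.16);
* `fubiniStudyConnectionPotential_smul_add_smul` — the **gauge behaviour**
  `γ₀(cZ)(ca + μZ) = γ₀(Z)(a) + μ/c` (`c ≠ 0`): unlike `β₀`, `γ₀` does not descend to `ℙ(W)` but
  changes by the logarithmic differential of the rescaling (Kobayashi (1987), Ch. I (1.16) for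
  rank one: `ω_U = ω_V + g⁻¹ dg`);
* the pull-back `fsConnectionPullback E G = G^*γ₀` along a map `G : M → W` of a complex manifold:
  `fsConnectionPullback_apply`, `fsConnectionPullback_congr_of_eventuallyEq`,
  `smoothAt_fsConnectionPullback`,
  `mextDeriv_fsConnectionPullback` (**`d(G^*γ₀) = i G^*β₀`** at the points where `G` is
  holomorphic and non-zero; `d` commutes with pull-back, `ManifoldFormsPullback`), and
  `fsConnectionPullback_smul_apply` (**gauge law** `(fG)^*γ₀ = G^*γ₀ + f⁻¹ df` for `f`
  holomorphic, `f ≠ 0`), together with `mextDeriv_ofFun_apply_eq_mvfderiv` (the differential of a function as a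
  `1`-form is Mathlib's `mvfderiv`).

Consumer: the tautological cocycle `𝒪(-1)|_{X^an}` of a smooth projective variety with its
Fubini–Study Chern connection (`Literature/AlgebraicGeometry/Motives/AnalytificationTautologicalBundle`),
whose `p`-th Chern character form is `(-θ/2π)ᵖ/p!`, `θ` the Kähler form of `GAGAKaehlerImmersionProofs`
— the top-degree case of Voisin I, Thm. 11.32 (`HolomorphicBundleChernCharacter`).

## References

* P. Griffiths, J. Harris, *Principles of Algebraic Geometry* (Wiley 1978), Ch. 0 §5 pp. 71–73
  (Chern connection of a Hermitian holomorphic bundle, `θ = ∂ log h` for line bundles), Ch. 0 §2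
  pp. 30–31 (Fubini–Study metric), Ch. 1 §1 p. 141 (curvature of `𝒪(1)`).
* C. Voisin, *Hodge Theory and Complex Algebraic Geometry I* (CUP 2002), §3.3.1 Def. 3.5,
  Thm. 3.13, §3.3.2 Lemma 3.16.
* S. Kobayashi, *Differential Geometry of Complex Vector Bundles* (1987), Ch. I §1 (1.16), §4
  (4.9)–(4.12) (Hermitian connections of line bundles).
-/

noncomputable section

open scoped ComplexConjugate InnerProductSpace ContDiff Topology Manifold
open Complex ContinuousLinearMap Bundle Set Filter

namespace Literature.Geometry.Kaehler

variable {W : Type*} [NormedAddCommGroup W] [InnerProductSpace ℂ W]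

/-! ## Part 1. The connection form `γ₀ = ∂ log ‖Z‖²` on `W ∖ {0}` -/

/-- The **Fubini–Study connection potential**: the complex-valued real-linear `1`-form
`γ₀(Z)(a) = ⟪Z, a⟫ / ‖Z‖²` on `W` (meaningful off `0`), i.e. `γ₀ = ∂ log ‖Z‖²`
(`Re γ₀ = ½ d log ‖Z‖²`, `Im γ₀ = α₀`): the connection form of the Chern connection of the metric
`‖·‖²` on the tautological line in the tautological frame (Griffiths–Harris (1978), p. 73,
`θ = ∂ log h`). [cite: GriffithsHarris1978, Ch. 0 §5 p. 73] -/
def fubiniStudyConnectionPotential (Z : W) : W [⋀^Fin 1]→L[ℝ] ℂ :=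
  ContinuousAlternatingMap.ofSubsingleton ℝ W ℂ (0 : Fin 1) ((‖Z‖ ^ 2)⁻¹ • innerBil Z)

/-- Evaluation of the connection potential: `γ₀(Z)(v) = ‖Z‖⁻² ⟪Z, v⟫`.
[cite: GriffithsHarris1978, Ch. 0 §5 p. 73] -/
@[simp]
theorem fubiniStudyConnectionPotential_apply (Z : W) (v : Fin 1 → W) :
    fubiniStudyConnectionPotential Z v = ((‖Z‖ ^ 2)⁻¹ : ℝ) • ⟪Z, v 0⟫_ℂ := by
  simp [fubiniStudyConnectionPotential]

/-- The imaginary part of `γ₀` is the Fubini–Study potential `α₀` of `FubiniStudy`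
(`γ₀ = ½ d log ‖Z‖² + i α₀`). [cite: VoisinHodgeI2002, §3.3.2 Lemma 3.16] -/
theorem fubiniStudyConnectionPotential_im (Z : W) (v : Fin 1 → W) :
    (fubiniStudyConnectionPotential Z v).im = fubiniStudyPotential Z v := by
  rw [fubiniStudyConnectionPotential_apply, Complex.smul_im, smul_eq_mul, fubiniStudyPotential_apply]

/-- The real part of `γ₀` is `‖Z‖⁻² Re⟪Z, v⟫ = ½ (d log ‖Z‖²)(v)`. [folklore] -/
theorem fubiniStudyConnectionPotential_re (Z : W) (v : Fin 1 → W) :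
    (fubiniStudyConnectionPotential Z v).re = (‖Z‖ ^ 2)⁻¹ * (⟪Z, v 0⟫_ℂ).re := by
  rw [fubiniStudyConnectionPotential_apply, Complex.smul_re, smul_eq_mul]

/-- The connection potential is `C^∞` off the origin. [folklore] -/
theorem contDiffAt_fubiniStudyConnectionPotential {Z : W} (hZ : Z ≠ 0) :
    ContDiffAt ℝ ∞ (fubiniStudyConnectionPotential (W := W)) Z := by
  have hρ : ContDiffAt ℝ ∞ (fun Y : W ↦ (‖Y‖ ^ 2)⁻¹) Z :=
    ((contDiff_norm_sq ℂ (n := ∞)).contDiffAt).inv (pow_ne_zero 2 (norm_ne_zero_iff.2 hZ))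
  have h : ContDiffAt ℝ ∞ (fun Y : W ↦ (‖Y‖ ^ 2)⁻¹ • innerBil Y) Z :=
    hρ.smul (innerBil (W := W)).contDiff.contDiffAt
  exact (ContinuousAlternatingMap.ofSubsingletonLIE (𝕜 := ℝ) (E := W) (F := ℂ)
    (0 : Fin 1)).toContinuousLinearEquiv.contDiff.comp_contDiffAt Z h

/-! ### `dγ₀ = i β₀` -/

/-- The derivative of a coefficient `Y ↦ ‖Y‖⁻² ⟪Y, b⟫` of the connection potential, evaluated:
`D_a (‖Y‖⁻² ⟪Y, b⟫)|_{Y=Z} = ‖Z‖⁻² ⟪a, b⟫ - 2 ‖Z‖⁻⁴ Re⟪Z, a⟫ ⟪Z, b⟫`. [folklore] -/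
theorem fderiv_connectionCoeff_apply {Z : W} (hZ : Z ≠ 0) (a b : W) :
    fderiv ℝ (fun Y : W ↦ ((‖Y‖ ^ 2)⁻¹ : ℝ) • ⟪Y, b⟫_ℂ) Z a =
      ((‖Z‖ ^ 2)⁻¹ : ℝ) • ⟪a, b⟫_ℂ
        - ((2 * ((‖Z‖ ^ 2) ^ 2)⁻¹ * (⟪Z, a⟫_ℂ).re : ℝ)) • ⟪Z, b⟫_ℂ := by
  have hne : ‖Z‖ ^ 2 ≠ 0 := pow_ne_zero 2 (norm_ne_zero_iff.2 hZ)
  have hinv : HasFDerivAt (fun Y : W ↦ (‖Y‖ ^ 2)⁻¹)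
      ((toSpanSingleton ℝ (-((‖Z‖ ^ 2) ^ 2)⁻¹)).comp ((2 : ℝ) • reCLM.comp (innerBil Z))) Z :=
    (hasFDerivAt_inv hne).comp Z (hasFDerivAt_norm_sq_inner Z)
  have hb : HasFDerivAt (fun Y : W ↦ ⟪Y, b⟫_ℂ) ((innerBil (W := W)).flip b) Z :=
    ((innerBil (W := W)).flip b).hasFDerivAt
  have hmul : HasFDerivAt (fun Y : W ↦ ((‖Y‖ ^ 2)⁻¹ : ℝ) • ⟪Y, b⟫_ℂ) _ Z := hinv.smul hb
  rw [hmul.fderiv]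
  simp only [add_apply, smul_apply, ContinuousLinearMap.comp_apply, smulRight_apply,
    ContinuousLinearMap.flip_apply, innerBil_apply, reCLM_apply, toSpanSingleton_apply,
    smul_eq_mul]
  rw [sub_eq_add_neg, ← neg_smul]
  congr 1
  ring_nf

/-- **The curvature of the Fubini–Study connection form is `i` times the Fubini–Study form:
`dγ₀ = i β₀`** off the origin. Indeed `γ₀ = ½ d log ‖Z‖² + i α₀` and `β₀ = dα₀`; here by the
explicit computation of both sides (`fubiniStudyForm_apply`). With `ch₁ = -Ω/2πi` this is
"`(i/2π) Θ(𝒪(1)) = ω_FS`" (Griffiths–Harris (1978), pp. 30–31, 141; Voisin (2002), §3.3.2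
Lemma 3.16 and Thm. 3.13). [cite: GriffithsHarris1978, Ch. 1 §1 p. 141] -/
theorem extDeriv_fubiniStudyConnectionPotential_apply {Z : W} (hZ : Z ≠ 0) (v : Fin 2 → W) :
    extDeriv (fubiniStudyConnectionPotential (W := W)) Z v = I * (fubiniStudyForm Z v : ℂ) := by
  have hdiff : DifferentiableAt ℝ (fubiniStudyConnectionPotential (W := W)) Z :=
    (contDiffAt_fubiniStudyConnectionPotential hZ).differentiableAt (by simp)
  rw [extDeriv_apply hdiff, Fin.sum_univ_two, fubiniStudyForm_apply hZ]
  simp only [fubiniStudyConnectionPotential_apply, Fin.removeNth, Fin.succAbove_zero,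
    Fin.succ_zero_eq_one, Fin.one_succAbove_zero, Fin.val_zero, Fin.val_one,
    fderiv_connectionCoeff_apply hZ, pow_zero, pow_one, one_smul, neg_smul, one_smul]
  have h10re : (⟪v 1, v 0⟫_ℂ).re = (⟪v 0, v 1⟫_ℂ).re := by
    rw [← inner_conj_symm, conj_re]
  have h10im : (⟪v 1, v 0⟫_ℂ).im = -(⟪v 0, v 1⟫_ℂ).im := by
    rw [← inner_conj_symm, conj_im]
  apply Complex.ext
  · simp only [add_re, neg_re, sub_re, Complex.smul_re, smul_eq_mul, mul_re, I_re, I_im,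
      Complex.ofReal_re, Complex.ofReal_im, h10re]
    ring
  · simp only [add_im, neg_im, sub_im, Complex.smul_im, smul_eq_mul, mul_im, I_re, I_im,
      Complex.ofReal_re, Complex.ofReal_im, h10im]
    ring

/-! ### Gauge behaviour of `γ₀` -/

/-- **Gauge behaviour of the connection potential**: for `c ≠ 0`,
`γ₀(cZ)(ca + μZ) = γ₀(Z)(a) + μ/c`. The form `γ₀` does not descend to `ℙ(W)`: rescaling the
frame by `c` adds the logarithmic differential `c⁻¹ dc` (Kobayashi (1987), Ch. I (1.16), rank one:
`ω_U = ω_V + g⁻¹ dg`). [cite: Kobayashi1987, Ch. I §1 (1.16)] -/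
theorem fubiniStudyConnectionPotential_smul_add_smul {Z : W} (hZ : Z ≠ 0) {c : ℂ} (hc : c ≠ 0)
    (μ : ℂ) (a : W) :
    fubiniStudyConnectionPotential (c • Z) ![c • a + μ • Z] =
      fubiniStudyConnectionPotential Z ![a] + μ * c⁻¹ := by
  have hZZ : ⟪Z, Z⟫_ℂ = ((‖Z‖ ^ 2 : ℝ) : ℂ) := by
    rw [inner_self_eq_norm_sq_to_K]
    push_cast
    rfl
  have hcc : (starRingEnd ℂ) c * c = ((‖c‖ ^ 2 : ℝ) : ℂ) := by
    rw [mul_comm, Complex.mul_conj, Complex.normSq_eq_norm_sq]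
  simp only [fubiniStudyConnectionPotential_apply, Matrix.cons_val_zero, inner_add_right,
    inner_smul_left, inner_smul_right, norm_smul, mul_pow, hZZ, Complex.real_smul]
  have hcne : ((‖c‖ : ℝ) : ℂ) ≠ 0 := by exact_mod_cast norm_ne_zero_iff.2 hc
  have hZne : ((‖Z‖ : ℝ) : ℂ) ≠ 0 := by exact_mod_cast norm_ne_zero_iff.2 hZ
  have hconj : (starRingEnd ℂ) c = ((‖c‖ ^ 2 : ℝ) : ℂ) * c⁻¹ := by
    rw [← hcc, mul_assoc, mul_inv_cancel₀ hc, mul_one]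
  rw [hconj]
  push_cast
  field_simp

end Literature.Geometry.Kaehler

/-! ## Part 2. The pull-back `G^*γ₀` along a holomorphic map -/

namespace Literature.Geometry.Kaehler

variable {E : Type*} [NormedAddCommGroup E] [NormedSpace ℂ E]
  {M : Type*} [TopologicalSpace M] [ChartedSpace E M]
  {W : Type*} [NormedAddCommGroup W] [InnerProductSpace ℂ W]

/-- The connection potential `γ₀` as a form on the manifold `W` (modelled on itself).
[cite: GriffithsHarris1978, Ch. 0 §5 p. 73] -/
def fubiniStudyConnectionMForm : MForm 𝓘(ℝ, W) W ℂ 1 := fun Z ↦ (fubiniStudyConnectionPotential Z :)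

/-- Unfolding of `fubiniStudyConnectionMForm` (definitional). [folklore] -/
@[simp]
theorem fubiniStudyConnectionMForm_apply (Z : W) :
    fubiniStudyConnectionMForm (W := W) Z = (fubiniStudyConnectionPotential Z :) := rfl

/-- **`dγ₀ = i β₀` as forms on `W`**, at every `Z ≠ 0`. [cite: GriffithsHarris1978, Ch. 1 §1 p. 141] -/
theorem mextDeriv_fubiniStudyConnectionMForm {Z : W} (hZ : Z ≠ 0) :
    mextDeriv (fubiniStudyConnectionMForm (W := W)) Z = I • (fubiniStudyMForm (W := W)).ofReal Z := by
  rw [mextDeriv_eq_extDeriv]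
  ext v
  change extDeriv (fubiniStudyConnectionPotential (W := W)) Z v = I * ((fubiniStudyForm Z v : ℝ) : ℂ)
  exact extDeriv_fubiniStudyConnectionPotential_apply hZ v

variable (E) in
/-- **The pulled-back connection form** `G^*γ₀ = ∂ log ‖G‖²` of a map `G : M → W` (meaningful
where `G` is holomorphic and non-zero): the connection form, in the holomorphic frame `G`, of the
Chern connection of the metric `‖G‖²` on the line sub-bundle spanned by `G` (the tautological line
`𝒪(-1)` pulled back along `[G] : M → ℙ(W)`); its negative is the connection form of the dual metric
`1/‖G‖²` on `𝒪(1)` in the dual frame. Griffiths–Harris (1978), p. 73 (`θ = ∂ log h`); Voisin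
(2002), §3.3.1–3.3.2. [cite: GriffithsHarris1978, Ch. 0 §5 p. 73] -/
def fsConnectionPullback (G : M → W) : MForm 𝓘(ℝ, E) M ℂ 1 :=
  (fubiniStudyConnectionMForm (W := W)).pullback 𝓘(ℝ, E) G

/-- Any `v : Fin 1 → X` is `![v 0]`. [folklore] -/
theorem eq_vecCons_one {X : Type*} (v : Fin 1 → X) : v = ![v 0] := by
  funext i
  fin_cases i
  rfl

/-- Evaluation of the pulled-back connection form:
`(G^*γ₀)(m)(v) = ‖G m‖⁻² ⟪G m, dG_m v⟫`, `dG_m = mvfderiv 𝓘(ℝ, E) G m` the real differential.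
[cite: GriffithsHarris1978, Ch. 0 §5 p. 73] -/
theorem fsConnectionPullback_apply (G : M → W) (m : M) (v : Fin 1 → TangentSpace 𝓘(ℝ, E) m) :
    fsConnectionPullback E G m v =
      ((‖G m‖ ^ 2)⁻¹ : ℝ) • ⟪G m, mvfderiv 𝓘(ℝ, E) G m (v 0)⟫_ℂ := by
  simp only [fsConnectionPullback, MForm.pullback_apply, fubiniStudyConnectionMForm_apply]
  rfl

/-- `(G^*γ₀)(m)` only depends on the germ of `G` at `m`. [folklore] -/
theorem fsConnectionPullback_congr_of_eventuallyEq {G G' : M → W} {m : M} (h : G =ᶠ[𝓝 m] G') :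
    fsConnectionPullback E G m = fsConnectionPullback E G' m := by
  ext v
  rw [fsConnectionPullback_apply, fsConnectionPullback_apply, mvfderiv_congr_of_eventuallyEq h,
    h.self_of_nhds]

section Smooth

variable [FiniteDimensional ℂ E] [IsManifold 𝓘(ℂ, E) ω M] [IsManifold 𝓘(ℝ, E) ∞ M]
  [FiniteDimensional ℂ W]
  {G : M → W} {U : Set M}

/-- **`G^*γ₀` is smooth** at the points of `U` (`G` holomorphic on the open set `U`, `G m ≠ 0`):
pull-back of a form smooth off `0` along a `C^∞` map. [cite: GriffithsHarris1978, Ch. 0 §5 p. 73] -/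
theorem smoothAt_fsConnectionPullback (hG : MDifferentiableOn 𝓘(ℂ, E) 𝓘(ℂ, W) G U) (hU : IsOpen U)
    {m : M} (hm : m ∈ U) (h0 : G m ≠ 0) : (fsConnectionPullback E G).SmoothAt m :=
  MForm.SmoothAt.pullback (eventually_contMDiffAt_real hG hU hm)
    ((MForm.smoothAt_model_iff (fubiniStudyConnectionMForm (W := W)) _).2
      (contDiffAt_fubiniStudyConnectionPotential h0))

/-- **The curvature of the pulled-back connection form: `d(G^*γ₀) = i G^*β₀`** at the points of
`U` (`d` commutes with pull-back at smooth points, `mextDeriv_pullback_apply`; `dγ₀ = iβ₀`). With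
`ch₁ = -Ω/2πi` and `Ω = ∓ d(G^*γ₀)` this says that the first Chern form of `𝒪(±1)` with the
Fubini–Study metric is `± (1/2π) G^*β₀` (Griffiths–Harris (1978), p. 141; Voisin (2002), Thm. 3.13
and Lemma 3.16). [cite: GriffithsHarris1978, Ch. 1 §1 p. 141] -/
theorem mextDeriv_fsConnectionPullback (hG : MDifferentiableOn 𝓘(ℂ, E) 𝓘(ℂ, W) G U) (hU : IsOpen U)
    {m : M} (hm : m ∈ U) (h0 : G m ≠ 0) :
    mextDeriv (fsConnectionPullback E G) m = I • (fsPullback E G).ofReal m := by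
  rw [fsConnectionPullback, mextDeriv_pullback_apply (eventually_contMDiffAt_real hG hU hm)
    ((MForm.smoothAt_model_iff (fubiniStudyConnectionMForm (W := W)) _).2
      (contDiffAt_fubiniStudyConnectionPotential h0))]
  ext v
  rw [MForm.pullback_apply, mextDeriv_fubiniStudyConnectionMForm h0]
  rfl

end Smooth

section Gauge

variable {G : M → W} {m : M}

/-- **Gauge law for the pulled-back connection form**: for `f : M → ℂ` and `G` holomorphic at `m`
with `f m ≠ 0`, `G m ≠ 0`,
`((fG)^*γ₀)(m)(v) = (G^*γ₀)(m)(v) + (f m)⁻¹ df_m(v)` — changing the holomorphic frame `G` of the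
line by the unit `f` adds `f⁻¹ df` (Kobayashi (1987), Ch. I (1.16) in rank one; Griffiths–Harris
(1978), p. 72: `θ' = g⁻¹ θ g + g⁻¹ dg`). From `d(fG) = f dG + df ⊗ G` and
`γ₀(cZ)(ca + μZ) = γ₀(Z)(a) + μ/c`. [cite: Kobayashi1987, Ch. I §1 (1.16)] -/
theorem fsConnectionPullback_smul_apply {f : M → ℂ} (hf : MDifferentiableAt 𝓘(ℂ, E) 𝓘(ℂ, ℂ) f m)
    (hG : MDifferentiableAt 𝓘(ℂ, E) 𝓘(ℂ, W) G m) (hf0 : f m ≠ 0) (h0 : G m ≠ 0)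
    (v : TangentSpace 𝓘(ℝ, E) m) :
    fsConnectionPullback E (fun x ↦ f x • G x) m ![v] =
      fsConnectionPullback E G m ![v] + (f m)⁻¹ * mvfderiv 𝓘(ℝ, E) f m v := by
  have hfG : MDifferentiableAt 𝓘(ℂ, E) 𝓘(ℂ, W) (fun x ↦ f x • G x) m := hf.smul hG
  -- `d(fG) v = f(m) dG v + (df v) G(m)`
  have key : mvfderiv 𝓘(ℝ, E) (fun x ↦ f x • G x) m v =
      f m • mvfderiv 𝓘(ℝ, E) G m v + (mvfderiv 𝓘(ℝ, E) f m v) • G m := by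
    rw [mvfderiv_real_apply_eq_complex hfG, mvfderiv_real_apply_eq_complex hG,
      mvfderiv_real_apply_eq_complex hf, mvfderiv_fun_smul hf hG]
    simp
  simp only [fsConnectionPullback, MForm.pullback_apply, fubiniStudyConnectionMForm_apply]
  have e1 : (fun i : Fin 1 ↦ (mfderiv 𝓘(ℝ, E) 𝓘(ℝ, W) (fun x ↦ f x • G x) m) (![v] i)) =
      ![f m • mvfderiv 𝓘(ℝ, E) G m v + (mvfderiv 𝓘(ℝ, E) f m v) • G m] := by
    rw [← key]; funext i; fin_cases i; rfl
  have e2 : (fun i : Fin 1 ↦ (mfderiv 𝓘(ℝ, E) 𝓘(ℝ, W) G m) (![v] i)) = ![mvfderiv 𝓘(ℝ, E) G m v] := by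
    funext i; fin_cases i; rfl
  rw [e1, e2]
  change fubiniStudyConnectionPotential (f m • G m)
      ![f m • mvfderiv 𝓘(ℝ, E) G m v + (mvfderiv 𝓘(ℝ, E) f m v) • G m] =
    fubiniStudyConnectionPotential (G m) ![mvfderiv 𝓘(ℝ, E) G m v] + (f m)⁻¹ * mvfderiv 𝓘(ℝ, E) f m v
  rw [fubiniStudyConnectionPotential_smul_add_smul h0 hf0]
  ring

end Gauge

/-! ### The differential of a function as a `1`-form is `mvfderiv` -/

section OfFun

variable [IsManifold 𝓘(ℝ, E) ∞ M] {F' : Type*} [NormedAddCommGroup F'] [NormedSpace ℝ F']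

/-- **`d` of a `0`-form is Mathlib's vector-valued differential**: for `f : M → F'` differentiable
at `x`, `d(f)(x)(v) = mvfderiv 𝓘(ℝ, E) f x (v 0)` (both are the derivative of `f` read in the chart
at `x`; Warner (1983), 2.20(a)). [cite: WarnerGTM94, 2.20] -/
theorem mextDeriv_ofFun_apply_eq_mvfderiv {f : M → F'} {x : M}
    (hf : MDifferentiableAt 𝓘(ℝ, E) 𝓘(ℝ, F') f x) (v : Fin 1 → TangentSpace 𝓘(ℝ, E) x) :
    mextDeriv (MForm.ofFun 𝓘(ℝ, E) f) x v = mvfderiv 𝓘(ℝ, E) f x (v 0) := by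
  rw [mextDeriv_ofFun_apply]
  simp only [mvfderiv, ContinuousLinearMap.coe_comp, Function.comp_apply, hf.mfderiv,
    writtenInExtChartAt, extChartAt_model_space_eq_id, PartialEquiv.refl_coe,
    ModelWithCorners.Boundaryless.range_eq_univ, fderivWithin_univ, Function.id_comp]
  rfl

end OfFun

end Literature.Geometry.Kaehler

end
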